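/-
Copyright (c) 2026 the pub-hodgecm-mathlib formalisation cell (harness21).  Prover seat hodgecm-mathlib-K2E5-p10 (g2),
Track B «K2-LIT» ∕ h413 (stmt-HodgeConjecture-24833), engine E5 «TamagawaUnitary», unit G organ (O6) FILE A (defs):
THE ARCHIMEDEAN × FINITE SPLITTING OF THE BASE TORUS `𝕀_{L⁺} ≅ fixedAdelicUnits L ≃ₜ* (Π_{w∣∞} ℝˣ) × (𝔸_{L⁺,f})^×`, its compatibility with the reduced norm
`Nrd = (Nrd_∞, Nrd_f)` of `D_h`, and the induced splitting of the image torus `Nrd((D_h ⊗ 𝔸)^×)`.  2026-09-04.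
-/
import Summits.HodgeConjecture.HodgeConjecture.Theorems.K2E5QuatFinNrdDefs              -- ★ (23) (K2E5-p08, p855960): `fixedFinAdelicUnits`, `mem_fixedFinAdelicUnits_iff`; brings ★ #3m ED.2 (`adeleFst`∕`adeleSnd` currency), ★ #3i `fixedAdelicUnits`
import Literature.NumberTheory.Automorphic.UnitaryGroupArchimedeanPlaces               -- ★ `isEmpty_isReal`, `mixedSpace_ext`; brings ★ `evalC`, `conjMixed`, `evalC_conjMixed`, `complexConj_smul_infinitePlace`
import HarnessLib

/-!
# K2_E5 road (h413 = stmt-HodgeConjecture-24833), unit G organ (O6), FILE A: the arch × fin splitting of the base torus `fixedAdelicUnits L`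

Cell `pub/hodgecm-mathlib` (D-0151), Track B; dealer K2E5-plan (g2), SWEEP #15 (2026-09-04T00:44:41Z) «(O6) `K2E5FixedIdeleBaseComparison` ↦ K2E5-p10 (g2)» for
K2E5-p17 (g2)'s G13 head (`Zeta.sig_K2E5QuatUnitsBetaEqSmulProduct` :372; REPORT-FIRST (31), organ (O6 = 31c)): «`fixedAdelicUnits L ≃ₜ* fixedArchUnits × fixedFinAdelicUnits L`
compatible with `quatAdelicNrd = (Nrd_∞ × quatFinNrd) ∘ quatAdelicProdEquiv`; `quatNrdImage(h) ↔ im_∞(h) × im_f` (`im_f` = ALL of `fixedFinAdelicUnits`, ★ p856025)».  This is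
FILE A (definitions + structure); FILE B `K2E5FixedIdeleBaseComparison` carries the measures.

For a CM field `L` (`c` = complex conjugation, `L⁺` its fixed field, `W := {w : InfinitePlace L // IsComplex w}` = all infinite places, each fixed by `c`,
★ `complexConj_smul_infinitePlace`; no real places, ★ `isEmpty_isReal`):

* §1 `realToMixed L : (W → ℝ) →+* mixedSpace L` (complex coordinates `(r w : ℂ)`), `archOfReal L : (W → ℝ) →+* InfiniteAdeleRing L` (through Mathlib
  `InfiniteAdeleRing.ringEquiv_mixedSpace`), `evalC_ringEquiv_archOfReal`, `conjMixed_realToMixed` ∕ `smul_archOfReal` (the real arch vectors are `c ⊗ 1`-FIXED,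
  ★ `evalC_conjMixed` + `conj (r : ℂ) = r`), `archUnitsOfReal L : (W → ℝˣ) →* (InfiniteAdeleRing L)ˣ`.
* §2 `ideleOfArchFin L : (W → ℝˣ) × (FiniteAdeleRing (𝓞 L) L)ˣ →* (AdeleRing (𝓞 L) L)ˣ` (`MulEquiv.prodUnits.symm` on `𝔸_L = L_∞ × 𝔸_{L,f}`), its two components,
  **`ideleOfArchFin_mem_fixedAdelicUnits_iff : _ (r, t) ∈ fixedAdelicUnits L ↔ t ∈ fixedFinAdelicUnits L`** (★ `AdeleRing.smul_fst`∕`smul_snd`).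
* §3 the inverse coordinates of a fixed idèle `u`: `archCoord L u w = Re (evalC w (ringEquiv_mixedSpace (u_∞)))` (a unit; the coordinate IS real: `conj_archCoordC`),
  `finCoord L u = (u_f ∈ fixedFinAdelicUnits)`; and **`fixedIdeleSplitEquiv L : (W → ℝˣ) × ↥(fixedFinAdelicUnits L) ≃ₜ* ↥(fixedAdelicUnits L)`** with `coe_fixedIdeleSplitEquiv_apply`,
  `fixedIdeleSplitEquiv_symm_apply_fst∕snd`.
* the compatibility with the reduced norm `Nrd = (Nrd_∞, Nrd_f)` of `D_h` and the induced splitting of the image torus `quatNrdImage` are in the sibling file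
  `K2E5QuatNrdImageSplitting` (same deal (O6)); the measures in `K2E5FixedIdeleBaseComparison`.

[cite: CasselsFrohlichANT1967, Ch. II §14 (idèles of an extension; `𝕀 = 𝕀_∞ × 𝕀_f`), Ch. VII §1.1] [cite: BorelJacquet1979, §4.1 (`G(𝔸) = G_∞ × G(𝔸_f)`)]
[cite: VignerasLNM800, Ch. III §1–§2 (n_A = (n_v)_v, n(H_A^×))] [cite: WeilBNT1967, Ch. IV §4]

HONEST LABEL: HC_CM is proved only modulo the 7 printed citations (2 remaining named inputs: hLiu418 = stmt-HodgeConjecture-24832,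
h413 = stmt-HodgeConjecture-24833) until rung 0 closes; this file is a `--supports stmt-HodgeConjecture-24833 --as helper` defs leaf (definitions + structural lemmas;
no `instance`, no `notation`, no `sorry`, no `def … : Prop`) and retires nothing by itself.
-/

set_option autoImplicit false
set_option linter.dupNamespace false   -- `Summit.HodgeConjecture.HodgeConjecture.…` (D-0017 nested layout; lakefile exemption for Summits)

noncomputable section

namespace Summit.HodgeConjecture.HodgeConjecture.Cruxes.H413.K2E5FixedIdeleBaseSplitting

open NumberField NumberField.InfinitePlace NumberField.mixedEmbedding IsDedekindDomain Topology
open Literature.NumberTheory.Automorphic Literature.NumberTheory.Automorphic.UnitaryGroup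
open Summit.HodgeConjecture.HodgeConjecture.Cruxes.H413.K2E5QuatAdelicMatrixModel
open Summit.HodgeConjecture.HodgeConjecture.Cruxes.H413.K2E5QuatAdelicNrd
open Summit.HodgeConjecture.HodgeConjecture.Cruxes.H413.K2E5QuatAdelicRestrictedProduct
open Summit.HodgeConjecture.HodgeConjecture.Cruxes.H413.K2E5QuatAdelicProdDecomposition
open Summit.HodgeConjecture.HodgeConjecture.Cruxes.H413.K2E5QuatFinNrd
open scoped Matrix MatrixGroups ComplexConjugate

variable (L : Type) [Field L] [NumberField L] [IsCMField L]

/-! ## §1 Real archimedean vectors: `(W → ℝ) →+* L ⊗_ℚ ℝ →+* L_∞`, fixed by `c ⊗ 1` -/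

/-- A CM field has no real place (★ `isEmpty_isReal` with ★ `complexConj_smul_infinitePlace`, `IsCMField.complexConj_ne_one`). [folklore] -/
theorem isEmpty_isReal_cm : IsEmpty {w : InfinitePlace L // IsReal w} :=
  isEmpty_isReal (↥(maximalRealSubfield L)) L (IsCMField.complexConj L) (IsCMField.complexConj_ne_one L) (complexConj_smul_infinitePlace L)

/-- **`realToMixed : (W → ℝ) →+* L ⊗_ℚ ℝ = ℝ^{r₁} × ℂ^{r₂}`** — the real vector `r` as the element of the mixed space with complex coordinates `(r w : ℂ)` (there are no real
coordinates for a CM field). [cite: CasselsFrohlichANT1967, Ch. II §14] -/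
def realToMixed : ({w : InfinitePlace L // IsComplex w} → ℝ) →+* mixedSpace L :=
  haveI : IsEmpty {w : InfinitePlace L // IsReal w} := isEmpty_isReal_cm L
  RingHom.prod (RingHom.pi fun v => isEmptyElim v)
    (RingHom.pi fun w => Complex.ofRealHom.comp (Pi.evalRingHom (fun _ : {w : InfinitePlace L // IsComplex w} => ℝ) w))

/-- The complex coordinate of `realToMixed r` at `w` is `(r w : ℂ)`. [folklore] -/
@[simp] theorem evalC_realToMixed (r : {w : InfinitePlace L // IsComplex w} → ℝ) (w : {w : InfinitePlace L // IsComplex w}) :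
    evalC L w (realToMixed L r) = ((r w : ℝ) : ℂ) :=
  rfl

/-- `realToMixed` is continuous. [folklore] -/
theorem continuous_realToMixed : Continuous (realToMixed L) := by
  haveI : IsEmpty {w : InfinitePlace L // IsReal w} := isEmpty_isReal_cm L
  refine continuous_prodMk.2 ⟨continuous_pi fun v => isEmptyElim v, continuous_pi fun w => ?_⟩
  exact Complex.continuous_ofReal.comp (continuous_apply w)

/-- **Real vectors are `c ⊗ 1`-fixed**: `conjMixed c (realToMixed r) = realToMixed r` (coordinatewise `conj (r w : ℂ) = r w`, ★ `evalC_conjMixed`, ★ `mixedSpace_ext`).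
[cite: CasselsFrohlichANT1967, Ch. II §14] -/
theorem conjMixed_realToMixed (r : {w : InfinitePlace L // IsComplex w} → ℝ) :
    conjMixed (↥(maximalRealSubfield L)) L (IsCMField.complexConj L) (realToMixed L r) = realToMixed L r := by
  refine mixedSpace_ext (↥(maximalRealSubfield L)) L (IsCMField.complexConj L) (IsCMField.complexConj_ne_one L) (complexConj_smul_infinitePlace L)
    fun w => ?_
  have h := evalC_conjMixed (↥(maximalRealSubfield L)) L (IsCMField.complexConj L) (complexConj_smul_infinitePlace L w.1)
    (IsCMField.complexConj_ne_one L) (realToMixed L r)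
  rw [evalC_apply, evalC_apply] at h
  rw [h]
  change conj (evalC L w (realToMixed L r)) = evalC L w (realToMixed L r)
  rw [evalC_realToMixed, Complex.conj_ofReal]

/-- **`archOfReal : (W → ℝ) →+* L_∞`** — `realToMixed` transported to the infinite adèle ring along Mathlib `InfiniteAdeleRing.ringEquiv_mixedSpace`.
[cite: CasselsFrohlichANT1967, Ch. II §14] -/
def archOfReal : ({w : InfinitePlace L // IsComplex w} → ℝ) →+* InfiniteAdeleRing L :=
  (InfiniteAdeleRing.ringEquiv_mixedSpace L).symm.toRingHom.comp (realToMixed L)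

/-- `ringEquiv_mixedSpace (archOfReal r) = realToMixed r`. [folklore] -/
@[simp] theorem ringEquiv_archOfReal (r : {w : InfinitePlace L // IsComplex w} → ℝ) :
    InfiniteAdeleRing.ringEquiv_mixedSpace L (archOfReal L r) = realToMixed L r :=
  (InfiniteAdeleRing.ringEquiv_mixedSpace L).apply_symm_apply _

/-- The complex coordinate of `archOfReal r` at `w` is `(r w : ℂ)`. [folklore] -/
theorem evalC_ringEquiv_archOfReal (r : {w : InfinitePlace L // IsComplex w} → ℝ) (w : {w : InfinitePlace L // IsComplex w}) :
    evalC L w (InfiniteAdeleRing.ringEquiv_mixedSpace L (archOfReal L r)) = ((r w : ℝ) : ℂ) := by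
  rw [ringEquiv_archOfReal, evalC_realToMixed]

/-- `archOfReal` is continuous (★ `continuous_ringEquiv_mixedSpace_symm`). [folklore] -/
theorem continuous_archOfReal : Continuous (archOfReal L) :=
  (continuous_ringEquiv_mixedSpace_symm L).comp (continuous_realToMixed L)

/-- **`c ⊗ 1` fixes `archOfReal r`** (the Galois action on `L_∞` is `conjMixed` transported, ★ `ringEquiv_symm_conjMixed`). [cite: CasselsFrohlichANT1967, Ch. II §14] -/
theorem smul_archOfReal (r : {w : InfinitePlace L // IsComplex w} → ℝ) : IsCMField.complexConj L • archOfReal L r = archOfReal L r := by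
  have h := ringEquiv_symm_conjMixed (↥(maximalRealSubfield L)) L (IsCMField.complexConj L) (realToMixed L r)
  rw [conjMixed_realToMixed] at h
  exact h.symm

/-- **`archUnitsOfReal : (W → ℝˣ) →* L_∞^×`** — units version of `archOfReal` (Mathlib `MulEquiv.piUnits`, `Units.map`). [cite: CasselsFrohlichANT1967, Ch. II §14] -/
def archUnitsOfReal : ({w : InfinitePlace L // IsComplex w} → ℝˣ) →* (InfiniteAdeleRing L)ˣ :=
  (Units.map (archOfReal L).toMonoidHom).comp (MulEquiv.piUnits.symm.toMonoidHom)

/-- Underlying infinite adèle of `archUnitsOfReal r`: `archOfReal (fun w => r w)`. [folklore] -/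
@[simp] theorem coe_archUnitsOfReal (r : {w : InfinitePlace L // IsComplex w} → ℝˣ) :
    ((archUnitsOfReal L r : (InfiniteAdeleRing L)ˣ) : InfiniteAdeleRing L) = archOfReal L (fun w => (r w : ℝ)) :=
  rfl

/-- `archUnitsOfReal` is continuous. [folklore] -/
theorem continuous_archUnitsOfReal : Continuous (archUnitsOfReal L) :=
  ((continuous_archOfReal L).units_map (archOfReal L).toMonoidHom).comp ContinuousMulEquiv.piUnits.symm.continuous

/-- The Galois action on `𝔸_L = L_∞ × 𝔸_{L,f}` is componentwise: archimedean part (★ `AdeleRing.smul_fst`, read through ★ `adeleFst`). [folklore] -/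
theorem adeleFst_smul (x : AdeleRing (𝓞 L) L) :
    adeleFst L (IsCMField.complexConj L • x) = IsCMField.complexConj L • adeleFst L x :=
  Literature.NumberTheory.Automorphic.AdeleRing.smul_fst (↥(maximalRealSubfield L)) (IsCMField.complexConj L) x

/-- The Galois action on `𝔸_L = L_∞ × 𝔸_{L,f}` is componentwise: finite part (★ `AdeleRing.smul_snd`, ★ `conjFiniteAdele_apply`). [folklore] -/
theorem adeleSnd_smul (x : AdeleRing (𝓞 L) L) :
    adeleSnd L (IsCMField.complexConj L • x) = IsCMField.complexConj L • adeleSnd L x :=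
  Literature.NumberTheory.Automorphic.AdeleRing.smul_snd (↥(maximalRealSubfield L)) (IsCMField.complexConj L) x

/-! ## §2 `(W → ℝˣ) × 𝔸_{L,f}^× →* 𝕀_L` and the fixed idèles -/

/-- **`ideleOfArchFin (r, t) := ((archOfReal r), t) ∈ 𝕀_L = (L_∞ × 𝔸_{L,f})^×`** (Mathlib `MulEquiv.prodUnits`). [cite: CasselsFrohlichANT1967, Ch. II §14] -/
def ideleOfArchFin : ({w : InfinitePlace L // IsComplex w} → ℝˣ) × (FiniteAdeleRing (𝓞 L) L)ˣ →* (AdeleRing (𝓞 L) L)ˣ :=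
  (MulEquiv.prodUnits (M := InfiniteAdeleRing L) (N := FiniteAdeleRing (𝓞 L) L)).symm.toMonoidHom.comp
    ((archUnitsOfReal L).prodMap (MonoidHom.id (FiniteAdeleRing (𝓞 L) L)ˣ))

/-- Archimedean component of `ideleOfArchFin (r, t)` (★ `adeleFst`). [folklore] -/
@[simp] theorem coe_ideleOfArchFin_fst (p : ({w : InfinitePlace L // IsComplex w} → ℝˣ) × (FiniteAdeleRing (𝓞 L) L)ˣ) :
    adeleFst L ((ideleOfArchFin L p : (AdeleRing (𝓞 L) L)ˣ) : AdeleRing (𝓞 L) L) = archOfReal L (fun w => (p.1 w : ℝ)) :=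
  rfl

/-- Finite component of `ideleOfArchFin (r, t)` (★ `adeleSnd`). [folklore] -/
@[simp] theorem coe_ideleOfArchFin_snd (p : ({w : InfinitePlace L // IsComplex w} → ℝˣ) × (FiniteAdeleRing (𝓞 L) L)ˣ) :
    adeleSnd L ((ideleOfArchFin L p : (AdeleRing (𝓞 L) L)ˣ) : AdeleRing (𝓞 L) L) = (p.2 : FiniteAdeleRing (𝓞 L) L) :=
  rfl

/-- Finite component as a unit: `Units.map adeleSnd (ideleOfArchFin (r, t)) = t`. [folklore] -/
@[simp] theorem units_map_adeleSnd_ideleOfArchFin (p : ({w : InfinitePlace L // IsComplex w} → ℝˣ) × (FiniteAdeleRing (𝓞 L) L)ˣ) :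
    Units.map (adeleSnd L).toMonoidHom (ideleOfArchFin L p) = p.2 :=
  Units.ext rfl

/-- `ideleOfArchFin` is continuous (Mathlib `Homeomorph.prodUnits`). [folklore] -/
theorem continuous_ideleOfArchFin : Continuous (ideleOfArchFin L) :=
  (Homeomorph.prodUnits (α := InfiniteAdeleRing L) (β := FiniteAdeleRing (𝓞 L) L)).symm.continuous.comp
    ((continuous_archUnitsOfReal L).prodMap continuous_id)

/-- **`ideleOfArchFin (r, t)` is `c ⊗ 1`-fixed iff `t` is**: the archimedean real vector is always fixed (`smul_archOfReal`), and the action is componentwise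
(★ `AdeleRing.smul_fst`, `AdeleRing.smul_snd`). [cite: CasselsFrohlichANT1967, Ch. II §14] -/
theorem ideleOfArchFin_mem_fixedAdelicUnits_iff (p : ({w : InfinitePlace L // IsComplex w} → ℝˣ) × (FiniteAdeleRing (𝓞 L) L)ˣ) :
    ideleOfArchFin L p ∈ fixedAdelicUnits L ↔ p.2 ∈ fixedFinAdelicUnits L := by
  rw [mem_fixedAdelicUnits_iff, mem_fixedFinAdelicUnits_iff, adeleConj_apply, conjFiniteAdele_apply]
  constructor
  · intro h
    have h2 := congrArg (adeleSnd L) h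
    rwa [adeleSnd_smul] at h2
  · intro h
    refine Prod.ext ?_ ?_
    · change adeleFst L (IsCMField.complexConj L • (ideleOfArchFin L p : AdeleRing (𝓞 L) L)) = adeleFst L (ideleOfArchFin L p : AdeleRing (𝓞 L) L)
      rw [adeleFst_smul, coe_ideleOfArchFin_fst, smul_archOfReal]
    · change adeleSnd L (IsCMField.complexConj L • (ideleOfArchFin L p : AdeleRing (𝓞 L) L)) = adeleSnd L (ideleOfArchFin L p : AdeleRing (𝓞 L) L)
      rw [adeleSnd_smul]
      exact h

/-! ## §3 The coordinates of a fixed idèle and the splitting `fixedIdeleSplitEquiv` -/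

/-- The complex archimedean coordinate of an idèle `u` at `w`: `evalC w (ringEquiv_mixedSpace (u_∞))`. [folklore] -/
def archCoordC (u : (AdeleRing (𝓞 L) L)ˣ) (w : {w : InfinitePlace L // IsComplex w}) : ℂ :=
  evalC L w (InfiniteAdeleRing.ringEquiv_mixedSpace L (adeleFst L (u : AdeleRing (𝓞 L) L)))

omit [IsCMField L] in
/-- Unfolding of `archCoordC`. [folklore] -/
theorem archCoordC_def (u : (AdeleRing (𝓞 L) L)ˣ) (w : {w : InfinitePlace L // IsComplex w}) :
    archCoordC L u w = evalC L w (InfiniteAdeleRing.ringEquiv_mixedSpace L (adeleFst L (u : AdeleRing (𝓞 L) L))) := rfl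

omit [IsCMField L] in
/-- `archCoordC` is multiplicative in `u` (a composite of ring homomorphisms). [folklore] -/
theorem archCoordC_mul (u u' : (AdeleRing (𝓞 L) L)ˣ) (w : {w : InfinitePlace L // IsComplex w}) :
    archCoordC L (u * u') w = archCoordC L u w * archCoordC L u' w := by
  simp only [archCoordC_def, Units.val_mul, map_mul]

omit [IsCMField L] in
/-- `archCoordC 1 w = 1`. [folklore] -/
theorem archCoordC_one (w : {w : InfinitePlace L // IsComplex w}) : archCoordC L 1 w = 1 := by
  simp only [archCoordC_def, Units.val_one, map_one]

omit [IsCMField L] in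
/-- The complex archimedean coordinates of an idèle are non-zero. [folklore] -/
theorem archCoordC_ne_zero (u : (AdeleRing (𝓞 L) L)ˣ) (w : {w : InfinitePlace L // IsComplex w}) : archCoordC L u w ≠ 0 := by
  have h : archCoordC L u w * archCoordC L u⁻¹ w = 1 := by rw [← archCoordC_mul, mul_inv_cancel, archCoordC_one]
  exact left_ne_zero_of_mul_eq_one h

/-- **The archimedean coordinates of a FIXED idèle are real**: `conj (archCoordC u w) = archCoordC u w` (★ `evalC_conjMixed`, ★ `conjMixed_ringEquiv`).
[cite: CasselsFrohlichANT1967, Ch. II §14] -/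
theorem conj_archCoordC {u : (AdeleRing (𝓞 L) L)ˣ} (hu : u ∈ fixedAdelicUnits L) (w : {w : InfinitePlace L // IsComplex w}) :
    conj (archCoordC L u w) = archCoordC L u w := by
  have hfix : IsCMField.complexConj L • adeleFst L (u : AdeleRing (𝓞 L) L) = adeleFst L (u : AdeleRing (𝓞 L) L) := by
    have h := (mem_fixedAdelicUnits_iff L u).1 hu
    rw [adeleConj_apply] at h
    have h1 := congrArg (adeleFst L) h
    rwa [adeleFst_smul] at h1
  have h := evalC_conjMixed (↥(maximalRealSubfield L)) L (IsCMField.complexConj L) (complexConj_smul_infinitePlace L w.1)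
    (IsCMField.complexConj_ne_one L) (InfiniteAdeleRing.ringEquiv_mixedSpace L (adeleFst L (u : AdeleRing (𝓞 L) L)))
  rw [conjMixed_ringEquiv, hfix] at h
  rw [archCoordC_def]
  exact h.symm

/-- Real coordinates: `archCoordC u w = ((archCoordC u w).re : ℂ)` for a fixed idèle. [cite: CasselsFrohlichANT1967, Ch. II §14] -/
theorem archCoordC_eq_ofReal_re {u : (AdeleRing (𝓞 L) L)ˣ} (hu : u ∈ fixedAdelicUnits L) (w : {w : InfinitePlace L // IsComplex w}) :
    archCoordC L u w = (((archCoordC L u w).re : ℝ) : ℂ) :=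
  (Complex.conj_eq_iff_re.1 (conj_archCoordC L hu w)).symm

/-- The real part of an archimedean coordinate of a fixed idèle is non-zero. [folklore] -/
theorem archCoordC_re_ne_zero {u : (AdeleRing (𝓞 L) L)ˣ} (hu : u ∈ fixedAdelicUnits L) (w : {w : InfinitePlace L // IsComplex w}) :
    (archCoordC L u w).re ≠ 0 := fun h0 =>
  archCoordC_ne_zero L u w (by rw [archCoordC_eq_ofReal_re L hu w, h0, Complex.ofReal_zero])

/-- **The real archimedean coordinates of a fixed idèle**, as units: `archCoord u w = Re (archCoordC u w) ∈ ℝˣ`. [cite: CasselsFrohlichANT1967, Ch. II §14] -/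
def archCoord (u : ↥(fixedAdelicUnits L)) (w : {w : InfinitePlace L // IsComplex w}) : ℝˣ :=
  Units.mk0 (archCoordC L (u : (AdeleRing (𝓞 L) L)ˣ) w).re (archCoordC_re_ne_zero L u.2 w)

/-- `(archCoord u w : ℝ) = Re (archCoordC u w)`. [folklore] -/
@[simp] theorem coe_archCoord (u : ↥(fixedAdelicUnits L)) (w : {w : InfinitePlace L // IsComplex w}) :
    ((archCoord L u w : ℝˣ) : ℝ) = (archCoordC L (u : (AdeleRing (𝓞 L) L)ˣ) w).re := rfl

/-- `((archCoord u w : ℝ) : ℂ) = archCoordC u w` (the coordinate is real). [folklore] -/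
theorem ofReal_coe_archCoord (u : ↥(fixedAdelicUnits L)) (w : {w : InfinitePlace L // IsComplex w}) :
    (((archCoord L u w : ℝˣ) : ℝ) : ℂ) = archCoordC L (u : (AdeleRing (𝓞 L) L)ˣ) w := by
  rw [coe_archCoord, ← archCoordC_eq_ofReal_re L u.2 w]

/-- **The finite coordinate of a fixed idèle** lies in `fixedFinAdelicUnits` (★ `AdeleRing.smul_snd`). [cite: CasselsFrohlichANT1967, Ch. II §14] -/
theorem units_map_snd_mem_fixedFinAdelicUnits (u : ↥(fixedAdelicUnits L)) :
    Units.map (adeleSnd L).toMonoidHom (u : (AdeleRing (𝓞 L) L)ˣ) ∈ fixedFinAdelicUnits L := by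
  rw [mem_fixedFinAdelicUnits_iff, conjFiniteAdele_apply, Units.coe_map]
  have h := (mem_fixedAdelicUnits_iff L (u : (AdeleRing (𝓞 L) L)ˣ)).1 u.2
  rw [adeleConj_apply] at h
  have h2 := congrArg (adeleSnd L) h
  rw [adeleSnd_smul] at h2
  exact h2

/-- The finite coordinate `u_f ∈ (𝔸_{L⁺,f})^×` of a fixed idèle. [cite: CasselsFrohlichANT1967, Ch. II §14] -/
def finCoord (u : ↥(fixedAdelicUnits L)) : ↥(fixedFinAdelicUnits L) :=
  ⟨Units.map (adeleSnd L).toMonoidHom (u : (AdeleRing (𝓞 L) L)ˣ), units_map_snd_mem_fixedFinAdelicUnits L u⟩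

/-- Underlying finite adèle of `finCoord u`: `(u : 𝔸_L).2`. [folklore] -/
@[simp] theorem coe_coe_finCoord (u : ↥(fixedAdelicUnits L)) :
    (((finCoord L u : ↥(fixedFinAdelicUnits L)) : (FiniteAdeleRing (𝓞 L) L)ˣ) : FiniteAdeleRing (𝓞 L) L) = adeleSnd L ((u : (AdeleRing (𝓞 L) L)ˣ) : AdeleRing (𝓞 L) L) :=
  rfl

/-- The arch × fin element rebuilt from the coordinates of a fixed idèle IS that idèle. [cite: CasselsFrohlichANT1967, Ch. II §14] -/
theorem ideleOfArchFin_archCoord_finCoord (u : ↥(fixedAdelicUnits L)) :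
    ideleOfArchFin L (archCoord L u, ((finCoord L u : ↥(fixedFinAdelicUnits L)) : (FiniteAdeleRing (𝓞 L) L)ˣ)) = (u : (AdeleRing (𝓞 L) L)ˣ) := by
  refine Units.ext (Prod.ext ?_ rfl)
  change adeleFst L ((ideleOfArchFin L (archCoord L u, ((finCoord L u : ↥(fixedFinAdelicUnits L)) : (FiniteAdeleRing (𝓞 L) L)ˣ)) : (AdeleRing (𝓞 L) L)ˣ) : AdeleRing (𝓞 L) L) =
    adeleFst L ((u : (AdeleRing (𝓞 L) L)ˣ) : AdeleRing (𝓞 L) L)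
  rw [coe_ideleOfArchFin_fst]
  apply (InfiniteAdeleRing.ringEquiv_mixedSpace L).injective
  rw [ringEquiv_archOfReal]
  refine mixedSpace_ext (↥(maximalRealSubfield L)) L (IsCMField.complexConj L) (IsCMField.complexConj_ne_one L) (complexConj_smul_infinitePlace L)
    fun w => ?_
  change evalC L w (realToMixed L fun w => ((archCoord L u w : ℝˣ) : ℝ)) = archCoordC L (u : (AdeleRing (𝓞 L) L)ˣ) w
  rw [evalC_realToMixed, ofReal_coe_archCoord]

/-- The coordinates of `ideleOfArchFin (r, t)`: archimedean. [folklore] -/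
theorem archCoordC_ideleOfArchFin (p : ({w : InfinitePlace L // IsComplex w} → ℝˣ) × (FiniteAdeleRing (𝓞 L) L)ˣ) (w : {w : InfinitePlace L // IsComplex w}) :
    archCoordC L (ideleOfArchFin L p) w = (((p.1 w : ℝˣ) : ℝ) : ℂ) := by
  rw [archCoordC_def, coe_ideleOfArchFin_fst, evalC_ringEquiv_archOfReal]

/-- **`fixedIdeleSplitEquiv : (W → ℝˣ) × (𝔸_{L⁺,f})^× ≃* 𝕀_{L⁺}`** (as the `c ⊗ 1`-fixed idèles of `L`): `(r, t) ↦ (archOfReal r, t)`, inverse `u ↦ (archCoord u, u_f)`.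
[cite: CasselsFrohlichANT1967, Ch. II §14] [cite: WeilBNT1967, Ch. IV §4] -/
def fixedIdeleSplitMulEquiv : (({w : InfinitePlace L // IsComplex w} → ℝˣ) × ↥(fixedFinAdelicUnits L)) ≃* ↥(fixedAdelicUnits L) where
  toFun p := ⟨ideleOfArchFin L (p.1, (p.2 : (FiniteAdeleRing (𝓞 L) L)ˣ)), (ideleOfArchFin_mem_fixedAdelicUnits_iff L _).2 p.2.2⟩
  invFun u := (archCoord L u, finCoord L u)
  left_inv p := by
    refine Prod.ext (funext fun w => Units.ext ?_) (Subtype.ext (Units.ext rfl))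
    change (archCoordC L (ideleOfArchFin L (p.1, (p.2 : (FiniteAdeleRing (𝓞 L) L)ˣ))) w).re = ((p.1 w : ℝˣ) : ℝ)
    rw [archCoordC_ideleOfArchFin, Complex.ofReal_re]
  right_inv u := Subtype.ext (ideleOfArchFin_archCoord_finCoord L u)
  map_mul' p q := Subtype.ext (by
    change ideleOfArchFin L ((p.1, (p.2 : (FiniteAdeleRing (𝓞 L) L)ˣ)) * (q.1, (q.2 : (FiniteAdeleRing (𝓞 L) L)ˣ))) = _
    rw [map_mul]
    rfl)

/-- Underlying idèle of `fixedIdeleSplitMulEquiv (r, t)`. [folklore] -/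
@[simp] theorem coe_fixedIdeleSplitMulEquiv_apply (p : ({w : InfinitePlace L // IsComplex w} → ℝˣ) × ↥(fixedFinAdelicUnits L)) :
    ((fixedIdeleSplitMulEquiv L p : ↥(fixedAdelicUnits L)) : (AdeleRing (𝓞 L) L)ˣ) = ideleOfArchFin L (p.1, (p.2 : (FiniteAdeleRing (𝓞 L) L)ˣ)) :=
  rfl

/-- `fixedIdeleSplitMulEquiv` is continuous. [folklore] -/
theorem continuous_fixedIdeleSplitMulEquiv : Continuous (fixedIdeleSplitMulEquiv L) :=
  continuous_induced_rng.2 ((continuous_ideleOfArchFin L).comp (continuous_fst.prodMk (continuous_subtype_val.comp continuous_snd)))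

/-- The archimedean coordinate map `u ↦ archCoord u` is continuous (into `W → ℝˣ`). [folklore] -/
theorem continuous_archCoord : Continuous (archCoord L) := by
  have hC : ∀ w : {w : InfinitePlace L // IsComplex w}, Continuous fun u : ↥(fixedAdelicUnits L) => archCoordC L (u : (AdeleRing (𝓞 L) L)ˣ) w := fun w =>
    (((continuous_apply w).comp continuous_snd).comp (continuous_ringEquiv_mixedSpace L)).comp
      ((continuous_fst.comp Units.continuous_val).comp continuous_subtype_val)
  refine continuous_pi fun w => Units.continuous_iff.2 ⟨Complex.continuous_re.comp (hC w), ?_⟩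
  have h : (fun u : ↥(fixedAdelicUnits L) => ((archCoord L u w)⁻¹ : ℝˣ).val) =
      fun u : ↥(fixedAdelicUnits L) => ((archCoordC L (u : (AdeleRing (𝓞 L) L)ˣ) w).re)⁻¹ := by
    funext u
    rw [Units.val_inv_eq_inv_val, coe_archCoord]
  rw [h]
  exact (Complex.continuous_re.comp (hC w)).inv₀ fun u => archCoordC_re_ne_zero L u.2 w

/-- The finite coordinate map `u ↦ u_f` is continuous. [folklore] -/
theorem continuous_finCoord : Continuous (finCoord L) :=
  continuous_induced_rng.2
    ((Continuous.units_map (adeleSnd L).toMonoidHom (continuous_snd : Continuous (adeleSnd L))).comp continuous_subtype_val)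

/-- **`fixedIdeleSplitEquiv L : (W → ℝˣ) × (𝔸_{L⁺,f})^× ≃ₜ* fixedAdelicUnits L`** — the archimedean × finite splitting of the base torus `𝕀_{L⁺}` (realised as the
`c ⊗ 1`-fixed idèles of `L`), as topological groups. [cite: CasselsFrohlichANT1967, Ch. II §14] [cite: BorelJacquet1979, §4.1] [cite: WeilBNT1967, Ch. IV §4] -/
def fixedIdeleSplitEquiv : (({w : InfinitePlace L // IsComplex w} → ℝˣ) × ↥(fixedFinAdelicUnits L)) ≃ₜ* ↥(fixedAdelicUnits L) :=
  { fixedIdeleSplitMulEquiv L with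
    continuous_toFun := continuous_fixedIdeleSplitMulEquiv L
    continuous_invFun := (continuous_archCoord L).prodMk (continuous_finCoord L) }

/-- Underlying idèle of `fixedIdeleSplitEquiv (r, t)`: `ideleOfArchFin (r, ↑t)`. [folklore] -/
@[simp] theorem coe_fixedIdeleSplitEquiv_apply (p : ({w : InfinitePlace L // IsComplex w} → ℝˣ) × ↥(fixedFinAdelicUnits L)) :
    ((fixedIdeleSplitEquiv L p : ↥(fixedAdelicUnits L)) : (AdeleRing (𝓞 L) L)ˣ) = ideleOfArchFin L (p.1, (p.2 : (FiniteAdeleRing (𝓞 L) L)ˣ)) :=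
  rfl

/-- First coordinate of the inverse: the real archimedean coordinates. [folklore] -/
@[simp] theorem fixedIdeleSplitEquiv_symm_apply_fst (u : ↥(fixedAdelicUnits L)) : ((fixedIdeleSplitEquiv L).symm u).1 = archCoord L u := rfl

/-- Second coordinate of the inverse: the finite part. [folklore] -/
@[simp] theorem fixedIdeleSplitEquiv_symm_apply_snd (u : ↥(fixedAdelicUnits L)) : ((fixedIdeleSplitEquiv L).symm u).2 = finCoord L u := rfl

end Summit.HodgeConjecture.HodgeConjecture.Cruxes.H413.K2E5FixedIdeleBaseSplitting

end
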